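import Literature.NumberTheory.NumberFields.HilbertClassField
import HarnessLib

/-!
# The Hilbert class field, part II: the Artin isomorphism `Cl(𝓞 K) ≅ Gal(H/K)`, `[H : K] = h_K`,
# and a prime splits completely iff it is principal (Cox Thm. 8.10 / Cor. 5.21; Neukirch VI (6.9))

Topic `NumberTheory/NumberFields` (class field theory); namespace
`Literature.NumberTheory.NumberFields.hilbertClassField`.  One definition with a body
(`hilbertClassField.artinEquiv`) and theorems, all PROVED; sequel of `HilbertClassField.lean`
(`H = hilbertClassField K = ⨆_ψ E_ψ ⊆ K̄`, the injective `Φ = galCharProd K : Gal(H/K) → ∏_ψ ℂˣ`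
descended from `Φ̃ = charProd K : Γ_K → ∏_ψ ℂˣ`, and the injective `Ψ = evalProd K : Cl(𝓞 K) → ∏_ψ ℂˣ`).

> Cox, *Primes of the form x² + ny²* (2nd ed.), §8.A **Theorem 8.10**: "… the Artin map induces an
> isomorphism `C(𝒪_K) ≅ Gal(L/K)`"; §5.C **Corollary 5.21**: "a prime ideal of `K` … splits
> completely in `L` if and only if it is a principal ideal"; Neukirch, *Algebraic Number Theory*,
> VI **(6.9)**: `Gal(K¹|K) ≅ Cl_K`, `[K¹ : K] = h_K`.

## Main results (`K : Type` a number field)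

* `charProd_eq_evalProd_of_isArithFrobAt` — `Φ̃(σ) = Ψ([v])` for every arithmetic Frobenius
  `σ ∈ Γ_K` at a prime of `ℤ̄_K` above `v`; `galCharProd_galFrob` — `Φ(Frob_v) = Ψ([v])`.
* `range_galCharProd_eq_range_evalProd` — `range Φ = range Ψ`: `⊇` because the prime classes
  generate `Cl(𝓞 K)`, `⊆` because the Frobenius elements generate `Gal(H/K)`
  (`closure_frobenius_eq_top_of_isGalois`) and each is `galFrob K H v` (`H|K` abelian, unramified).
* `hilbertClassField.artinEquiv K : ClassGroup (𝓞 K) ≃* Gal(H/K)` — **the Artin isomorphism**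
  (`Φ⁻¹ ∘ Ψ`), with **`artinEquiv [v] = Frob_v`** for every prime `v`, every prime `Q` of `H` above
  `v` and every arithmetic Frobenius at `Q` (`artinEquiv_mk0_eq_of_isArithFrobAt`,
  `artinEquiv_mk0_eq_galFrob`, `absRestrictNormalHom_eq_artinEquiv_mk0`).
* **`card_aut_eq_card_classGroup`, `finrank_eq_card_classGroup`, `finrank_eq_classNumber`:
  `[H : K] = h_K`.**
* **`mem_splitPrimes_iff_isPrincipal`: a prime of `K` splits completely in `H` iff it is
  principal** (every prime, no exceptional set); `eq_bot_iff_card_classGroup_eq_one`: `H = K` iff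
  `h_K = 1`.

## References

* D. A. Cox, *Primes of the form x² + ny²*, 2nd ed. (2013), §5.C Cor. 5.21, §8.A Thm. 8.10. [Cox2013]
* J. Neukirch, *Algebraic Number Theory* (1999), Ch. VI §6 Prop. (6.9), §7 Thm. (7.1), Cor. (7.4). [NeukirchANT1999]
-/

noncomputable section

open NumberField IsDedekindDomain Field
open scoped IsMulCommutative nonZeroDivisors

namespace Literature.NumberTheory.NumberFields

open Literature.NumberTheory.GaloisRepresentations Literature.NumberTheory.LFunctions

variable (K : Type) [Field K] [NumberField K]

namespace hilbertClassField

/-! ### §4. Frobenius: `Φ̃(σ_v) = Ψ([v])`, and `range Φ = range Ψ` -/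

/-- **`Φ̃(σ) = Ψ([v])`** for an arithmetic Frobenius `σ ∈ Γ_K` at a prime of `ℤ̄_K` above `v`.
[cite: NeukirchANT1999, Ch. VI §7 Thm. (7.1)] -/
theorem charProd_eq_evalProd_of_isArithFrobAt {v : HeightOneSpectrum (𝓞 K)}
    {𝔓 : Ideal (absIntegers (𝓞 K) K)} (h𝔓 : 𝔓 ∈ v.primesAbove) {σ : absoluteGaloisGroup K}
    (hσ : IsArithFrobAt (𝓞 K) σ 𝔓) :
    charProd K σ = evalProd K (ClassGroup.mk0 ⟨v.asIdeal, asIdeal_mem_nonZeroDivisors v⟩) := by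
  funext ψ
  rw [charProd_apply, evalProd_apply]
  exact classGroupCharField.character_absRestrictNormalHom_eq K ψ h𝔓 hσ

/-- For every prime `v` there is `σ ∈ Γ_K`, an arithmetic Frobenius at a prime of `ℤ̄_K` above `v`,
whose restriction to `H` is `galFrob K H v` and with `Φ̃(σ) = Ψ([v])` (step of the proof of Neukirch VI
(6.9) / (7.1)). [cite: NeukirchANT1999, Ch. VI §7 Thm. (7.1) (proof)] -/
theorem exists_frob (v : HeightOneSpectrum (𝓞 K)) :
    ∃ σ : absoluteGaloisGroup K,
      absRestrictNormalHom (hilbertClassField K) σ = galFrob K (hilbertClassField K) v ∧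
      charProd K σ = evalProd K (ClassGroup.mk0 ⟨v.asIdeal, asIdeal_mem_nonZeroDivisors v⟩) := by
  obtain ⟨𝔓, h𝔓⟩ := v.primesAbove_nonempty
  obtain ⟨σ, hσ⟩ := HeightOneSpectrum.exists_isArithFrobAt_of_mem_primesAbove_holds h𝔓
  haveI : 𝔓.IsPrime := h𝔓.1
  refine ⟨σ, ?_, charProd_eq_evalProd_of_isArithFrobAt K h𝔓 hσ⟩
  exact eq_galFrob (commute K) (isUnramifiedIn K v)
    (comap_ringOfIntegersToIntegralClosure_mem_primesOver_of_mem_primesAbove _ h𝔓)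
    (isArithFrobAt_absRestrictNormalHom _ hσ)

/-- `Φ(Frob_v) = Ψ([v])`. [cite: NeukirchANT1999, Ch. VI §7 Thm. (7.1)] -/
theorem galCharProd_galFrob (v : HeightOneSpectrum (𝓞 K)) :
    galCharProd K (galFrob K (hilbertClassField K) v) =
      evalProd K (ClassGroup.mk0 ⟨v.asIdeal, asIdeal_mem_nonZeroDivisors v⟩) := by
  obtain ⟨σ, hσ, h⟩ := exists_frob K v
  rw [← hσ, galCharProd_absRestrictNormalHom, h]

/-- **`range Φ = range Ψ`**: `⊇` since the prime classes generate `Cl(𝓞 K)`; `⊆` since the Frobenius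
elements generate `Gal(H/K)` and each is a `galFrob` (`H|K` abelian, unramified).
[cite: NeukirchANT1999, Ch. VI §6 Prop. (6.9)] -/
theorem range_galCharProd_eq_range_evalProd : (galCharProd K).range = (evalProd K).range := by
  classical
  apply le_antisymm
  · -- `Φ(Gal) = Φ(closure of Frobenii) ≤ range Ψ`
    have htop := closure_frobenius_eq_top_of_isGalois (K := K) (N := hilbertClassField K)
      (B := (∅ : Set (HeightOneSpectrum (𝓞 K)))) Set.finite_empty
    rintro _ ⟨g, rfl⟩
    have hg : g ∈ Subgroup.closure {φ : hilbertClassField K ≃ₐ[K] hilbertClassField K |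
        ∃ v : HeightOneSpectrum (𝓞 K), v ∉ (∅ : Set _) ∧
        ∃ Q ∈ v.asIdeal.primesOver (𝓞 (hilbertClassField K)), IsArithFrobAt (𝓞 K) φ Q} := by
      rw [htop]; exact Subgroup.mem_top g
    refine Subgroup.closure_induction (p := fun g _ => galCharProd K g ∈ (evalProd K).range)
      ?_ ?_ ?_ ?_ hg
    · rintro φ ⟨v, -, Q, hQ, hφ⟩
      rw [eq_galFrob (commute K) (isUnramifiedIn K v) hQ hφ, galCharProd_galFrob]
      exact ⟨_, rfl⟩
    · rw [map_one]; exact one_mem _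
    · intro a b _ _ ha hb
      rw [map_mul]; exact mul_mem ha hb
    · intro a _ ha
      rw [map_inv]; exact inv_mem ha
  · -- `Ψ(Cl) = Ψ(closure of prime classes) ≤ range Φ`
    rintro _ ⟨c, rfl⟩
    obtain ⟨I, rfl⟩ := ClassGroup.mk0_surjective c
    have hI : (I : Ideal (𝓞 K)) ≠ ⊥ := nonZeroDivisors.coe_ne_zero I
    have key : ∀ J : Ideal (𝓞 K), ∀ hJ : J ≠ ⊥,
        evalProd K (ClassGroup.mk0 ⟨J, mem_nonZeroDivisors_of_ne_zero hJ⟩) ∈ (galCharProd K).range := by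
      intro J
      induction J using UniqueFactorizationMonoid.induction_on_prime with
      | h₁ => intro hJ; exact absurd rfl hJ
      | h₂ J hJu =>
        intro hJ
        have h1 : ClassGroup.mk0 ⟨J, mem_nonZeroDivisors_of_ne_zero hJ⟩ = 1 := by
          obtain ⟨u, rfl⟩ := hJu
          have : (⟨(u : Ideal (𝓞 K)), mem_nonZeroDivisors_of_ne_zero hJ⟩ : (Ideal (𝓞 K))⁰) = 1 := by
            apply Subtype.ext
            simp [Ideal.isUnit_iff.mp u.isUnit]
          rw [this, map_one]
        rw [h1, map_one]
        exact one_mem _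
      | h₃ J P hJ0 hP ih =>
        intro hJP
        have hP0 : P ≠ ⊥ := hP.ne_zero
        have hmul : (⟨P * J, mem_nonZeroDivisors_of_ne_zero hJP⟩ : (Ideal (𝓞 K))⁰) =
            ⟨P, mem_nonZeroDivisors_of_ne_zero hP0⟩ * ⟨J, mem_nonZeroDivisors_of_ne_zero hJ0⟩ :=
          Subtype.ext rfl
        rw [hmul, map_mul, map_mul]
        refine mul_mem ?_ (ih hJ0)
        have hPprime : P.IsPrime := Ideal.isPrime_of_prime hP
        set v : HeightOneSpectrum (𝓞 K) := ⟨P, hPprime, hP0⟩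
        exact ⟨galFrob K (hilbertClassField K) v, galCharProd_galFrob K v⟩
    have : I = ⟨(I : Ideal (𝓞 K)), mem_nonZeroDivisors_of_ne_zero hI⟩ := Subtype.ext rfl
    rw [this]
    exact key _ hI

/-! ### §5. The Artin isomorphism `Cl(𝓞 K) ≅ Gal(H/K)` -/

/-- **The Artin isomorphism `Cl(𝓞 K) ≃* Gal(H/K)` of the Hilbert class field** (`Φ⁻¹ ∘ Ψ`:
`[𝔞] ↦ (H/K, 𝔞)`). [cite: Cox2013, §8.A Thm. 8.10] [cite: NeukirchANT1999, Ch. VI §6 Prop. (6.9)] -/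
def artinEquiv : ClassGroup (𝓞 K) ≃* (hilbertClassField K ≃ₐ[K] hilbertClassField K) :=
  (MonoidHom.ofInjective (evalProd_injective K)).trans
    ((MulEquiv.subgroupCongr (range_galCharProd_eq_range_evalProd K).symm).trans
      (MonoidHom.ofInjective (galCharProd_injective K)).symm)

/-- The defining relation of the Artin isomorphism: `Φ(artinEquiv c) = Ψ(c)`, i.e. `χ_ψ((artinEquiv c)|_{E_ψ}) = ψ(c)`
for every character `ψ`. [cite: Cox2013, §8.A Thm. 8.10] -/
theorem galCharProd_artinEquiv (c : ClassGroup (𝓞 K)) :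
    galCharProd K (artinEquiv K c) = evalProd K c := by
  unfold artinEquiv
  simp only [MulEquiv.trans_apply]
  set y : (galCharProd K).range := (MulEquiv.subgroupCongr (range_galCharProd_eq_range_evalProd K).symm)
    (MonoidHom.ofInjective (evalProd_injective K) c) with hy
  have h1 : (y : (ClassGroup (𝓞 K) →* ℂˣ) → ℂˣ) = evalProd K c := rfl
  have h2 := MonoidHom.apply_ofInjective_symm (galCharProd_injective K) y
  rw [h2, h1]

/-- **`artinEquiv [v] = Frob_v`** for every prime `v` of `K`, every prime `Q` of `H` above `v` and
every arithmetic Frobenius `φ` at `Q`. [cite: Cox2013, §8.A Thm. 8.10] [cite: NeukirchANT1999, Ch. VI §7 Thm. (7.1)] -/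
theorem artinEquiv_mk0_eq_of_isArithFrobAt {v : HeightOneSpectrum (𝓞 K)}
    {Q : Ideal (𝓞 (hilbertClassField K))} (hQ : Q ∈ v.asIdeal.primesOver (𝓞 (hilbertClassField K)))
    {φ : hilbertClassField K ≃ₐ[K] hilbertClassField K} (hφ : IsArithFrobAt (𝓞 K) φ Q) :
    artinEquiv K (ClassGroup.mk0 ⟨v.asIdeal, asIdeal_mem_nonZeroDivisors v⟩) = φ := by
  apply galCharProd_injective K
  rw [galCharProd_artinEquiv, eq_galFrob (commute K) (isUnramifiedIn K v) hQ hφ, galCharProd_galFrob]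

/-- `artinEquiv [v] = galFrob K H v`. [cite: Cox2013, §8.A Thm. 8.10] -/
theorem artinEquiv_mk0_eq_galFrob (v : HeightOneSpectrum (𝓞 K)) :
    artinEquiv K (ClassGroup.mk0 ⟨v.asIdeal, asIdeal_mem_nonZeroDivisors v⟩) =
      galFrob K (hilbertClassField K) v := by
  obtain ⟨Q, hQ, hφ⟩ := galFrob_spec K (hilbertClassField K) v
  exact artinEquiv_mk0_eq_of_isArithFrobAt K hQ hφ

/-- `artinEquiv [σ|...]`: for an arithmetic Frobenius `σ ∈ Γ_K` at a prime of `ℤ̄_K` above `v`,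
`σ|_H = artinEquiv [v]`. [cite: NeukirchANT1999, Ch. VI §7 Thm. (7.1)] -/
theorem absRestrictNormalHom_eq_artinEquiv_mk0 {v : HeightOneSpectrum (𝓞 K)}
    {𝔓 : Ideal (absIntegers (𝓞 K) K)} (h𝔓 : 𝔓 ∈ v.primesAbove) {σ : absoluteGaloisGroup K}
    (hσ : IsArithFrobAt (𝓞 K) σ 𝔓) :
    absRestrictNormalHom (hilbertClassField K) σ =
      artinEquiv K (ClassGroup.mk0 ⟨v.asIdeal, asIdeal_mem_nonZeroDivisors v⟩) := by
  haveI : 𝔓.IsPrime := h𝔓.1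
  exact (artinEquiv_mk0_eq_of_isArithFrobAt K
    (comap_ringOfIntegersToIntegralClosure_mem_primesOver_of_mem_primesAbove _ h𝔓)
    (isArithFrobAt_absRestrictNormalHom _ hσ)).symm

/-! ### §6. `[H : K] = h_K`; a prime splits completely iff it is principal -/

/-- **`|Gal(H/K)| = h_K`.** [cite: NeukirchANT1999, Ch. VI §6 Prop. (6.9)] -/
theorem card_aut_eq_card_classGroup :
    Nat.card (hilbertClassField K ≃ₐ[K] hilbertClassField K) = Fintype.card (ClassGroup (𝓞 K)) := by
  rw [← Nat.card_eq_fintype_card]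
  exact (Nat.card_congr (artinEquiv K).toEquiv).symm

/-- **`[H : K] = h_K`**: the degree of the Hilbert class field is the class number.
[cite: Cox2013, §8.A Thm. 8.10] [cite: NeukirchANT1999, Ch. VI §6 Prop. (6.9)] -/
theorem finrank_eq_card_classGroup :
    Module.finrank K (hilbertClassField K) = Fintype.card (ClassGroup (𝓞 K)) := by
  rw [← card_aut_eq_card_classGroup, IsGalois.card_aut_eq_finrank]

/-- `[H : K] = classNumber K`. [cite: NeukirchANT1999, Ch. VI §6 Prop. (6.9)] -/
theorem finrank_eq_classNumber :
    Module.finrank K (hilbertClassField K) = NumberField.classNumber K := by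
  rw [finrank_eq_card_classGroup]; rfl

/-- **A prime of `K` splits completely in the Hilbert class field iff it is principal** (Cox Cor. 5.21
for the Hilbert class field; every prime, no exceptional set). [cite: Cox2013, §5.C Cor. 5.21]
[cite: NeukirchANT1999, Ch. VI §7 Cor. (7.4)] -/
theorem mem_splitPrimes_iff_isPrincipal (v : HeightOneSpectrum (𝓞 K)) :
    v ∈ splitPrimes K (hilbertClassField K) ↔ v.asIdeal.IsPrincipal := by
  rw [mem_splitPrimes_iff_galFrob_eq_one (isUnramifiedIn K v), ← artinEquiv_mk0_eq_galFrob,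
    MulEquiv.map_eq_one_iff, ClassGroup.mk0_eq_one_iff]

/-- `H = K̄^{?}`-free restatement: **`K` has class number one iff its Hilbert class field is `K`**
(`H = ⊥` in `K̄`). [cite: Cox2013, §8.A Thm. 8.10] -/
theorem eq_bot_iff_card_classGroup_eq_one :
    hilbertClassField K = ⊥ ↔ Fintype.card (ClassGroup (𝓞 K)) = 1 := by
  rw [← finrank_eq_card_classGroup, IntermediateField.finrank_eq_one_iff]

end hilbertClassField

end Literature.NumberTheory.NumberFields

end
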